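import Summits.BirchSwinnertonDyer.BirchSwinnertonDyer.Theorems.GoldfeldGoodTwistsDensity
import Literature.NumberTheory.EllipticCurves.BSDSelmerSmithRootNumberDensityProofs
import HarnessLib

/-!
# Root-number equidistribution inside the family `𝓕 = {d squarefree : d ≡ 1 (mod 4)}`

Cell `bsd-goldfeld` (planner seat), file 4: the Goldfeld half (files 1–3 give rank BSD for `100 %`
of `𝓕`; file 5 assembles Goldfeld's `50 / 50` for `X₀(49)`). Theorems only — no named fact, no
axiom, no definition. HONEST FRAMING: this is the classical root-number equidistribution from the
Modularity Theorem (hypothesis `hmod : exists_isNewformOf`, as in the tree's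
`twistDensity_rootNumber_quadraticTwist_eq_one`) restricted to the positive-density subfamily `𝓕`;
the restriction is free because `𝓕` is a union of fibres of the tree's decomposition
`d = δ χ₄(m) m` — those with `δ ≡ 1 (mod 4)` (`mul_χ₄_mul_emod_four`, file 2).

* `abs_two_mul_card_rootNumber_sub_card_emod_four_le` — THE ESTIMATE
  `|2 #{d ∈ 𝓕 : |d| ≤ X, w(W^d) = +1} − #{d ∈ 𝓕 : |d| ≤ X}| ≤ C_W √X` (per fibre the tree's
  character sum `w(W^δ) ∑_m χ₄(m) J(N_{W^δ} Q² | m) = O(√X)`: `sum_rootNumber_fibre_eq`,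
  `abs_sum_squarefree_χ₄_mul_jacobiSym_le`).
* `tendsto_familyProportion_half_of_abs_le` — square-root error ⇒ relative density `1/2` in `𝓕`.
* `tendsto_familyProportion_rootNumber_eq_one` / `…_eq_neg_one` — root number `+1` (resp. `−1`)
  for `50 %` of `d ∈ 𝓕`.
* bookkeeping in `𝓕` for file 5: `familyProportion_congr`, `tendsto_familyProportion_compl`,
  `tendsto_familyProportion_of_congr_one`, `tendsto_familyProportion_and_one`.

References: M. R. Murty, V. K. Murty, *Non-vanishing of `L`-functions and applications* (1997),
Ch. 6 §1 [MurtyMurty1997]; A. Smith, arXiv:2503.17619, Thm. 1.1 [arXiv250317619];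
C. Breuil, B. Conrad, F. Diamond, R. Taylor, JAMS 14 (2001), Thm. A [BCDTJAMS2001].
-/

set_option linter.dupNamespace false
set_option autoImplicit false

noncomputable section

open Finset
open scoped NumberTheorySymbols Classical
open Filter Topology ZMod WeierstrassCurve Literature.NumberTheory.EllipticCurves
  Literature.NumberTheory.EllipticCurves.ModularForms

namespace Summit.BirchSwinnertonDyer.BirchSwinnertonDyer.Theorems.GoldfeldGoodTwists

/-! ## §1 The estimate in `𝓕` -/

section Estimate

variable (W : WeierstrassCurve ℚ) [W.IsElliptic]

/-- **The main estimate inside `𝓕`.** For an elliptic `W / ℚ` there is a constant `C = C_W` with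
`|2 #{d ∈ 𝓕, |d| ≤ X : w(W^d) = +1} − #{d ∈ 𝓕 : |d| ≤ X}| ≤ C √X` for all `X` (from the Modularity
Theorem; `d = 0` is not squarefree, so no `d ≠ 0` clause is needed). Along `d = δ χ₄(m) m` (`δ` a squarefree divisor of `Q = 2 N_W`, `m` squarefree coprime to
`Q`), `d ≡ δ (mod 4)`; so only the fibres `δ ≡ 1 (mod 4)` meet `𝓕`, and on each of them
`2 #{w = +1} − # = w(W^δ) ∑_m χ₄(m) J(N_{W^δ} Q² | m)` is `≤ 4 N_{W^δ} Q² √X` in absolute value.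
[cite: MurtyMurty1997, Ch. 6 §1] -/
theorem abs_two_mul_card_rootNumber_sub_card_emod_four_le (hmod : exists_isNewformOf) :
    ∃ C : ℝ, ∀ X : ℕ,
      |2 * (((Icc (-(X : ℤ)) X).filter fun d : ℤ ↦ Squarefree d ∧
          (d % 4 = 1 ∧ (W.quadraticTwist (d : ℚ)).rootNumber = 1)).card : ℝ) -
        ((Icc (-(X : ℤ)) X).filter fun d : ℤ ↦ Squarefree d ∧ d % 4 = 1).card| ≤
        C * Real.sqrt X := by
  set Q : ℕ := 2 * W.conductorNorm ℤ with hQ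
  have hQ0 : 0 < Q := by
    have := WeierstrassCurve.conductorNorm_pos_holds W
    rw [hQ]; omega
  have hQ2 : 2 ∣ Q := dvd_mul_right 2 _
  set T : Finset ℤ := (Icc (-(Q : ℤ)) Q).filter (fun δ ↦ Squarefree δ ∧ δ ∣ (Q : ℤ)) with hT
  -- the constant (the same as the tree's, all fibres)
  refine ⟨∑ δ ∈ T, (4 * ((W.quadraticTwist (δ : ℚ)).conductorNorm ℤ * Q ^ 2 : ℕ) : ℝ), fun X ↦ ?_⟩
  -- decompose both counts along `d = δ χ₄(m) m`
  have hA := card_filter_squarefree_eq_sum_card hQ0 hQ2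
    (fun d : ℤ ↦ d % 4 = 1 ∧ (W.quadraticTwist (d : ℚ)).rootNumber = 1) X
  have hB := card_filter_squarefree_eq_sum_card hQ0 hQ2 (fun d : ℤ ↦ d % 4 = 1) X
  -- fibrewise identity
  have hfib : ∀ δ ∈ T,
      (2 * ((((Icc 1 (X / δ.natAbs)).filter fun m : ℕ ↦
          Squarefree m ∧ m.Coprime Q ∧ ((δ * χ₄ (m : ZMod 4) * m) % 4 = 1 ∧
            (W.quadraticTwist ((δ * χ₄ (m : ZMod 4) * m : ℤ) : ℚ)).rootNumber = 1)).card : ℕ) : ℤ) -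
        (((Icc 1 (X / δ.natAbs)).filter fun m : ℕ ↦ Squarefree m ∧ m.Coprime Q ∧
          (δ * χ₄ (m : ZMod 4) * m) % 4 = 1).card : ℕ)) =
      if δ % 4 = 1 then (W.quadraticTwist (δ : ℚ)).rootNumber *
        ∑ m ∈ (Icc 1 (X / δ.natAbs)).filter (fun m : ℕ ↦ Squarefree m), χ₄ (m : ZMod 4) *
          J((((W.quadraticTwist (δ : ℚ)).conductorNorm ℤ * Q ^ 2 : ℕ) : ℤ) | m) else 0 := by
    intro δ hδ
    simp only [hT, mem_filter] at hδ
    obtain ⟨-, hδsq, hδQ⟩ := hδ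
    have hδ0 : δ ≠ 0 := hδsq.ne_zero
    split_ifs with hδ4
    · -- the fibre lies in `𝓕`
      have hset : ((Icc 1 (X / δ.natAbs)).filter fun m : ℕ ↦
            Squarefree m ∧ m.Coprime Q ∧ ((δ * χ₄ (m : ZMod 4) * m) % 4 = 1 ∧
              (W.quadraticTwist ((δ * χ₄ (m : ZMod 4) * m : ℤ) : ℚ)).rootNumber = 1)) =
          (((Icc 1 (X / δ.natAbs)).filter fun m : ℕ ↦ Squarefree m ∧ m.Coprime Q).filter
            fun m : ℕ ↦ (W.quadraticTwist ((δ * χ₄ (m : ZMod 4) * m : ℤ) : ℚ)).rootNumber = 1) := by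
        ext m
        simp only [mem_filter, mem_Icc]
        constructor
        · rintro ⟨hm, hsq, hcop, -, hw⟩; exact ⟨⟨hm, hsq, hcop⟩, hw⟩
        · rintro ⟨⟨hm, hsq, hcop⟩, hw⟩
          refine ⟨hm, hsq, hcop, ?_, hw⟩
          rw [mul_χ₄_mul_emod_four δ (odd_of_coprime_of_two_dvd hQ2 hcop)]; exact hδ4
      have hset' : ((Icc 1 (X / δ.natAbs)).filter fun m : ℕ ↦ Squarefree m ∧ m.Coprime Q ∧
            (δ * χ₄ (m : ZMod 4) * m) % 4 = 1) =
          ((Icc 1 (X / δ.natAbs)).filter fun m : ℕ ↦ Squarefree m ∧ m.Coprime Q) := by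
        ext m
        simp only [mem_filter, mem_Icc]
        constructor
        · rintro ⟨hm, hsq, hcop, -⟩; exact ⟨hm, hsq, hcop⟩
        · rintro ⟨hm, hsq, hcop⟩
          refine ⟨hm, hsq, hcop, ?_⟩
          rw [mul_χ₄_mul_emod_four δ (odd_of_coprime_of_two_dvd hQ2 hcop)]; exact hδ4
      rw [← sum_rootNumber_fibre_eq W hmod hδ0 hδQ, hset, hset']
      exact two_mul_card_filter_sub_card_eq_sum _
        (fun m _ ↦ WeierstrassCurve.rootNumber_eq_one_or _)
    · -- the fibre misses `𝓕`
      have hA0 : ((Icc 1 (X / δ.natAbs)).filter fun m : ℕ ↦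
            Squarefree m ∧ m.Coprime Q ∧ ((δ * χ₄ (m : ZMod 4) * m) % 4 = 1 ∧
              (W.quadraticTwist ((δ * χ₄ (m : ZMod 4) * m : ℤ) : ℚ)).rootNumber = 1)).card = 0 := by
        refine card_eq_zero.mpr (filter_eq_empty_iff.mpr fun m _ h ↦ hδ4 ?_)
        rw [← mul_χ₄_mul_emod_four δ (odd_of_coprime_of_two_dvd hQ2 h.2.1)]; exact h.2.2.1
      have hB0 : ((Icc 1 (X / δ.natAbs)).filter fun m : ℕ ↦ Squarefree m ∧ m.Coprime Q ∧
            (δ * χ₄ (m : ZMod 4) * m) % 4 = 1).card = 0 := by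
        refine card_eq_zero.mpr (filter_eq_empty_iff.mpr fun m _ h ↦ hδ4 ?_)
        rw [← mul_χ₄_mul_emod_four δ (odd_of_coprime_of_two_dvd hQ2 h.2.1)]; exact h.2.2
      rw [hA0, hB0]; simp
  -- sum the fibrewise identities
  have hmain : (2 * ((((Icc (-(X : ℤ)) X).filter fun d : ℤ ↦ Squarefree d ∧
      (d % 4 = 1 ∧ (W.quadraticTwist (d : ℚ)).rootNumber = 1)).card : ℕ) : ℤ) -
      (((Icc (-(X : ℤ)) X).filter fun d : ℤ ↦ Squarefree d ∧ d % 4 = 1).card : ℕ)) =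
      ∑ δ ∈ T, (if δ % 4 = 1 then (W.quadraticTwist (δ : ℚ)).rootNumber *
        ∑ m ∈ (Icc 1 (X / δ.natAbs)).filter (fun m : ℕ ↦ Squarefree m), χ₄ (m : ZMod 4) *
          J((((W.quadraticTwist (δ : ℚ)).conductorNorm ℤ * Q ^ 2 : ℕ) : ℤ) | m) else 0) := by
    rw [hA, hB]
    push_cast
    rw [mul_sum, ← sum_sub_distrib]
    refine sum_congr rfl fun δ hδ ↦ ?_
    have := hfib δ hδ
    push_cast at this
    exact this
  have hmainR : (2 * ((((Icc (-(X : ℤ)) X).filter fun d : ℤ ↦ Squarefree d ∧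
      (d % 4 = 1 ∧ (W.quadraticTwist (d : ℚ)).rootNumber = 1)).card : ℕ) : ℝ) -
      (((Icc (-(X : ℤ)) X).filter fun d : ℤ ↦ Squarefree d ∧ d % 4 = 1).card : ℕ)) =
      (((∑ δ ∈ T, if δ % 4 = 1 then (W.quadraticTwist (δ : ℚ)).rootNumber *
        ∑ m ∈ (Icc 1 (X / δ.natAbs)).filter (fun m : ℕ ↦ Squarefree m), χ₄ (m : ZMod 4) *
          J((((W.quadraticTwist (δ : ℚ)).conductorNorm ℤ * Q ^ 2 : ℕ) : ℤ) | m) else 0 : ℤ)) : ℝ) := by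
    exact_mod_cast hmain
  -- estimate
  rw [hmainR, Int.cast_sum, sum_mul]
  refine (abs_sum_le_sum_abs _ _).trans (sum_le_sum fun δ hδ ↦ ?_)
  have ha : 0 < (W.quadraticTwist (δ : ℚ)).conductorNorm ℤ * Q ^ 2 := by
    have hδ0 : (δ : ℚ) ≠ 0 := by
      simp only [hT, mem_filter] at hδ
      exact_mod_cast hδ.2.1.ne_zero
    haveI := W.isElliptic_quadraticTwist hδ0
    exact Nat.mul_pos (WeierstrassCurve.conductorNorm_pos_holds _) (pow_pos hQ0 2)
  have h1 := abs_sum_squarefree_χ₄_mul_jacobiSym_le ha (X / δ.natAbs)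
  have hw : |((W.quadraticTwist (δ : ℚ)).rootNumber : ℤ)| = 1 := by
    rcases WeierstrassCurve.rootNumber_eq_one_or (W.quadraticTwist (δ : ℚ)) with h | h <;>
      rw [h] <;> simp
  have h2 : |((if δ % 4 = 1 then (W.quadraticTwist (δ : ℚ)).rootNumber *
      ∑ m ∈ (Icc 1 (X / δ.natAbs)).filter (fun m : ℕ ↦ Squarefree m), χ₄ (m : ZMod 4) *
        J((((W.quadraticTwist (δ : ℚ)).conductorNorm ℤ * Q ^ 2 : ℕ) : ℤ) | m) else 0 : ℤ) : ℝ)| ≤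
      ((4 * ((W.quadraticTwist (δ : ℚ)).conductorNorm ℤ * Q ^ 2 : ℕ) * Nat.sqrt (X / δ.natAbs) :
        ℤ) : ℝ) := by
    rw [← Int.cast_abs]
    refine Int.cast_le.mpr ?_
    split_ifs
    · rw [abs_mul, hw, one_mul]; exact h1
    · rw [abs_zero]; positivity
  refine h2.trans ?_
  have hsqrt : ((Nat.sqrt (X / δ.natAbs) : ℕ) : ℝ) ≤ Real.sqrt X := by
    have h3 : Nat.sqrt (X / δ.natAbs) ≤ Nat.sqrt X := Nat.sqrt_le_sqrt (Nat.div_le_self _ _)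
    calc ((Nat.sqrt (X / δ.natAbs) : ℕ) : ℝ) ≤ (Nat.sqrt X : ℕ) := by exact_mod_cast h3
      _ = Real.sqrt (((Nat.sqrt X : ℕ) : ℝ) ^ 2) := (Real.sqrt_sq (Nat.cast_nonneg _)).symm
      _ ≤ Real.sqrt X := Real.sqrt_le_sqrt (by exact_mod_cast Nat.sqrt_le' X)
  push_cast
  exact mul_le_mul_of_nonneg_left hsqrt (by positivity)

/-- The estimate with `Nat.card` of sets (the currency of the density statements). [folklore] -/
theorem abs_two_mul_natCard_rootNumber_sub_natCard_emod_four_le (hmod : exists_isNewformOf) :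
    ∃ C : ℝ, ∀ X : ℕ,
      |2 * (Nat.card {d : ℤ | Squarefree d ∧ |d| ≤ (X : ℤ) ∧
          (d % 4 = 1 ∧ (W.quadraticTwist (d : ℚ)).rootNumber = 1)} : ℝ) -
        Nat.card {d : ℤ | Squarefree d ∧ |d| ≤ (X : ℤ) ∧ d % 4 = 1}| ≤ C * Real.sqrt X := by
  obtain ⟨C, hC⟩ := abs_two_mul_card_rootNumber_sub_card_emod_four_le W hmod
  refine ⟨C, fun X ↦ ?_⟩
  have h1 : Nat.card {d : ℤ | Squarefree d ∧ |d| ≤ (X : ℤ) ∧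
      (d % 4 = 1 ∧ (W.quadraticTwist (d : ℚ)).rootNumber = 1)} =
      ((Icc (-(X : ℤ)) X).filter fun d : ℤ ↦ Squarefree d ∧
          (d % 4 = 1 ∧ (W.quadraticTwist (d : ℚ)).rootNumber = 1)).card := by
    rw [natCard_setOf_squarefree_eq]
    exact le_antisymm (card_le_card fun d hd ↦ by simp only [mem_filter] at hd ⊢; exact hd)
      (card_le_card fun d hd ↦ by simp only [mem_filter] at hd ⊢; exact hd)
  have h2 : Nat.card {d : ℤ | Squarefree d ∧ |d| ≤ (X : ℤ) ∧ d % 4 = 1} =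
      ((Icc (-(X : ℤ)) X).filter fun d : ℤ ↦ Squarefree d ∧ d % 4 = 1).card := by
    rw [natCard_setOf_squarefree_eq]
    exact le_antisymm (card_le_card fun d hd ↦ by simp only [mem_filter] at hd ⊢; exact hd)
      (card_le_card fun d hd ↦ by simp only [mem_filter] at hd ⊢; exact hd)
  rw [h1, h2]
  exact hC X

end Estimate

/-! ## §2 Relative density `1/2` and bookkeeping in `𝓕` -/

section Density

/-- **A square-root error term gives relative density `1/2` in `𝓕`.** If
`|2 #{d ∈ 𝓕 : |d| ≤ X, P d} − #{d ∈ 𝓕 : |d| ≤ X}| ≤ C √X` for all `X`, then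
`#{d ∈ 𝓕 : |d| ≤ X, P d} / #{d ∈ 𝓕 : |d| ≤ X} → 1/2` (the denominator is `≥ X / 20`). [folklore] -/
theorem tendsto_familyProportion_half_of_abs_le {P : ℤ → Prop} {C : ℝ}
    (h : ∀ X : ℕ, |2 * (Nat.card {d : ℤ | Squarefree d ∧ |d| ≤ (X : ℤ) ∧ (d % 4 = 1 ∧ P d)} : ℝ) -
      Nat.card {d : ℤ | Squarefree d ∧ |d| ≤ (X : ℤ) ∧ d % 4 = 1}| ≤ C * Real.sqrt X) :
    Tendsto (fun X : ℕ ↦ (Nat.card {d : ℤ | Squarefree d ∧ |d| ≤ (X : ℤ) ∧ (d % 4 = 1 ∧ P d)} : ℝ) /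
      Nat.card {d : ℤ | Squarefree d ∧ |d| ≤ (X : ℤ) ∧ d % 4 = 1}) atTop (𝓝 (1 / 2)) := by
  have hC : 0 ≤ C := by
    have h1 := h 1
    have hs : Real.sqrt (1 : ℕ) = 1 := by simp
    rw [hs, mul_one] at h1
    exact (abs_nonneg _).trans h1
  -- the error bound `10C/√X → 0`
  have h0 : Tendsto (fun X : ℕ ↦ 10 * C / Real.sqrt X) atTop (𝓝 0) :=
    tendsto_const_nhds.div_atTop (Real.tendsto_sqrt_atTop.comp tendsto_natCast_atTop_atTop)
  have hlo : Tendsto (fun X : ℕ ↦ 1 / 2 - 10 * C / Real.sqrt X) atTop (𝓝 (1 / 2)) := by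
    simpa using tendsto_const_nhds.sub h0
  have hhi : Tendsto (fun X : ℕ ↦ 1 / 2 + 10 * C / Real.sqrt X) atTop (𝓝 (1 / 2)) := by
    simpa using tendsto_const_nhds.add h0
  -- the deviation bound for `X ≥ 1`
  have hdev : ∀ X : ℕ, 1 ≤ X →
      |(Nat.card {d : ℤ | Squarefree d ∧ |d| ≤ (X : ℤ) ∧ (d % 4 = 1 ∧ P d)} : ℝ) /
          Nat.card {d : ℤ | Squarefree d ∧ |d| ≤ (X : ℤ) ∧ d % 4 = 1} - 1 / 2| ≤
        10 * C / Real.sqrt X := by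
    intro X hX
    set A : ℝ := (Nat.card {d : ℤ | Squarefree d ∧ |d| ≤ (X : ℤ) ∧ d % 4 = 1} : ℝ) with hA
    set B : ℝ := (Nat.card {d : ℤ | Squarefree d ∧ |d| ≤ (X : ℤ) ∧ (d % 4 = 1 ∧ P d)} : ℝ)
      with hB
    have hApos : (X : ℝ) / 20 ≤ A := natCard_emod_four_ge X
    have hX1 : (1 : ℝ) ≤ X := by exact_mod_cast hX
    have hA0 : 0 < A := by linarith
    have hsqrt0 : 0 < Real.sqrt X := Real.sqrt_pos.mpr (by linarith)
    have heq : B / A - 1 / 2 = (2 * B - A) / (2 * A) := by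
      field_simp
    rw [heq, abs_div, abs_of_pos (by linarith : (0 : ℝ) < 2 * A)]
    have hXs : (X : ℝ) = Real.sqrt X * Real.sqrt X := (Real.mul_self_sqrt (by linarith)).symm
    rw [div_le_div_iff₀ (by linarith) hsqrt0]
    calc |2 * B - A| * Real.sqrt X ≤ C * Real.sqrt X * Real.sqrt X :=
          mul_le_mul_of_nonneg_right (h X) hsqrt0.le
      _ = C * X := by rw [mul_assoc, ← hXs]
      _ ≤ C * (20 * A) := mul_le_mul_of_nonneg_left (by linarith) hC
      _ = 10 * C * (2 * A) := by ring
  refine tendsto_of_tendsto_of_tendsto_of_le_of_le' hlo hhi ?_ ?_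
  · filter_upwards [eventually_ge_atTop 1] with X hX
    have := hdev X hX
    rw [abs_le] at this
    linarith [this.1]
  · filter_upwards [eventually_ge_atTop 1] with X hX
    have := hdev X hX
    rw [abs_le] at this
    linarith [this.2]

/-- Predicates agreeing on `𝓕` have the same counting function. [folklore] -/
theorem familyProportion_congr {P Q : ℤ → Prop}
    (h : ∀ d : ℤ, Squarefree d → d % 4 = 1 → (P d ↔ Q d)) :
    (fun X : ℕ ↦ (Nat.card {d : ℤ | Squarefree d ∧ |d| ≤ (X : ℤ) ∧ (d % 4 = 1 ∧ P d)} : ℝ) /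
      Nat.card {d : ℤ | Squarefree d ∧ |d| ≤ (X : ℤ) ∧ d % 4 = 1}) =
    (fun X : ℕ ↦ (Nat.card {d : ℤ | Squarefree d ∧ |d| ≤ (X : ℤ) ∧ (d % 4 = 1 ∧ Q d)} : ℝ) /
      Nat.card {d : ℤ | Squarefree d ∧ |d| ≤ (X : ℤ) ∧ d % 4 = 1}) := by
  funext X
  have hset : {d : ℤ | Squarefree d ∧ |d| ≤ (X : ℤ) ∧ (d % 4 = 1 ∧ P d)} =
      {d : ℤ | Squarefree d ∧ |d| ≤ (X : ℤ) ∧ (d % 4 = 1 ∧ Q d)} := by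
    ext d
    simp only [Set.mem_setOf_eq]
    constructor
    · rintro ⟨hsq, hle, h4, hP⟩; exact ⟨hsq, hle, h4, (h d hsq h4).1 hP⟩
    · rintro ⟨hsq, hle, h4, hQ⟩; exact ⟨hsq, hle, h4, (h d hsq h4).2 hQ⟩
  rw [hset]

/-- **Complements in `𝓕`.** If `P` holds for a proportion `→ δ` of `𝓕`, then `¬ P` holds for a
proportion `→ 1 − δ`. [folklore] -/
theorem tendsto_familyProportion_compl {P : ℤ → Prop} {δ : ℝ}
    (h : Tendsto (fun X : ℕ ↦ (Nat.card {d : ℤ | Squarefree d ∧ |d| ≤ (X : ℤ) ∧ (d % 4 = 1 ∧ P d)} : ℝ) /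
      Nat.card {d : ℤ | Squarefree d ∧ |d| ≤ (X : ℤ) ∧ d % 4 = 1}) atTop (𝓝 δ)) :
    Tendsto (fun X : ℕ ↦ (Nat.card {d : ℤ | Squarefree d ∧ |d| ≤ (X : ℤ) ∧ (d % 4 = 1 ∧ ¬ P d)} : ℝ) /
      Nat.card {d : ℤ | Squarefree d ∧ |d| ≤ (X : ℤ) ∧ d % 4 = 1}) atTop (𝓝 (1 - δ)) := by
  have h1 : Tendsto (fun X : ℕ ↦ 1 - (Nat.card {d : ℤ | Squarefree d ∧ |d| ≤ (X : ℤ) ∧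
      (d % 4 = 1 ∧ P d)} : ℝ) / Nat.card {d : ℤ | Squarefree d ∧ |d| ≤ (X : ℤ) ∧ d % 4 = 1})
      atTop (𝓝 (1 - δ)) := tendsto_const_nhds.sub h
  refine h1.congr' ?_
  filter_upwards [eventually_ge_atTop 1] with X hX
  have hF0 := natCard_emod_four_pos hX
  have hAB := natCard_emod_four_add P X
  rw [eq_div_iff hF0.ne', sub_mul, div_mul_cancel₀ _ hF0.ne', one_mul]
  have : (Nat.card {d : ℤ | Squarefree d ∧ |d| ≤ (X : ℤ) ∧ (d % 4 = 1 ∧ P d)} : ℝ) +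
      Nat.card {d : ℤ | Squarefree d ∧ |d| ≤ (X : ℤ) ∧ (d % 4 = 1 ∧ ¬ P d)} =
      Nat.card {d : ℤ | Squarefree d ∧ |d| ≤ (X : ℤ) ∧ d % 4 = 1} := by exact_mod_cast hAB
  linarith

/-- Counting bound behind `tendsto_familyProportion_of_congr_one`: if `Q → P` on `R` (inside `𝓕`),
then `#{Q} ≤ #{P} + #{¬ R}`. [folklore] -/
theorem natCard_le_natCard_add_natCard_not {P Q R : ℤ → Prop}
    (h : ∀ d : ℤ, Squarefree d → d % 4 = 1 → R d → Q d → P d) (X : ℕ) :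
    (Nat.card {d : ℤ | Squarefree d ∧ |d| ≤ (X : ℤ) ∧ (d % 4 = 1 ∧ Q d)} : ℝ) ≤
      Nat.card {d : ℤ | Squarefree d ∧ |d| ≤ (X : ℤ) ∧ (d % 4 = 1 ∧ P d)} +
        Nat.card {d : ℤ | Squarefree d ∧ |d| ≤ (X : ℤ) ∧ (d % 4 = 1 ∧ ¬ R d)} := by
  have h1 : Nat.card {d : ℤ | Squarefree d ∧ |d| ≤ (X : ℤ) ∧ (d % 4 = 1 ∧ Q d)} ≤
      Nat.card {d : ℤ | Squarefree d ∧ |d| ≤ (X : ℤ) ∧ (d % 4 = 1 ∧ P d)} +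
        Nat.card {d : ℤ | Squarefree d ∧ |d| ≤ (X : ℤ) ∧ (d % 4 = 1 ∧ ¬ R d)} := by
    rw [Nat.card_coe_set_eq, Nat.card_coe_set_eq, Nat.card_coe_set_eq]
    refine (Set.ncard_le_ncard (fun d hd ↦ ?_)
      ((finite_setOf_squarefree _ X).union (finite_setOf_squarefree _ X))).trans
      (Set.ncard_union_le _ _)
    simp only [Set.mem_setOf_eq, Set.mem_union] at hd ⊢
    obtain ⟨hsq, hle, h4, hQ⟩ := hd
    by_cases hRd : R d
    · exact Or.inl ⟨hsq, hle, h4, h d hsq h4 hRd hQ⟩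
    · exact Or.inr ⟨hsq, hle, h4, hRd⟩
  exact_mod_cast h1

/-- **Changing a predicate on a `100 %` subset of `𝓕`.** If `P` holds for a proportion `→ δ` of
`𝓕`, `R` holds for `100 %` of `𝓕`, and `P ↔ Q` on `R`, then `Q` holds for a proportion `→ δ` of `𝓕`.
[folklore] -/
theorem tendsto_familyProportion_of_congr_one {P Q R : ℤ → Prop} {δ : ℝ}
    (hP : Tendsto (fun X : ℕ ↦ (Nat.card {d : ℤ | Squarefree d ∧ |d| ≤ (X : ℤ) ∧ (d % 4 = 1 ∧ P d)} : ℝ) /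
      Nat.card {d : ℤ | Squarefree d ∧ |d| ≤ (X : ℤ) ∧ d % 4 = 1}) atTop (𝓝 δ))
    (hR : Tendsto (fun X : ℕ ↦ (Nat.card {d : ℤ | Squarefree d ∧ |d| ≤ (X : ℤ) ∧ (d % 4 = 1 ∧ R d)} : ℝ) /
      Nat.card {d : ℤ | Squarefree d ∧ |d| ≤ (X : ℤ) ∧ d % 4 = 1}) atTop (𝓝 1))
    (h : ∀ d : ℤ, Squarefree d → d % 4 = 1 → R d → (P d ↔ Q d)) :
    Tendsto (fun X : ℕ ↦ (Nat.card {d : ℤ | Squarefree d ∧ |d| ≤ (X : ℤ) ∧ (d % 4 = 1 ∧ Q d)} : ℝ) /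
      Nat.card {d : ℤ | Squarefree d ∧ |d| ≤ (X : ℤ) ∧ d % 4 = 1}) atTop (𝓝 δ) := by
  -- the proportion of `¬ R` tends to `0`
  have hnR := tendsto_familyProportion_compl hR
  rw [sub_self] at hnR
  -- `|#Q − #P| ≤ #¬R`
  have hQle := natCard_le_natCard_add_natCard_not (P := P) (Q := Q) (R := R)
    (fun d hsq h4 hRd hQ ↦ (h d hsq h4 hRd).2 hQ)
  have hPle := natCard_le_natCard_add_natCard_not (P := Q) (Q := P) (R := R)
    (fun d hsq h4 hRd hP' ↦ (h d hsq h4 hRd).1 hP')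
  have hlo : Tendsto (fun X : ℕ ↦ (Nat.card {d : ℤ | Squarefree d ∧ |d| ≤ (X : ℤ) ∧
      (d % 4 = 1 ∧ P d)} : ℝ) / Nat.card {d : ℤ | Squarefree d ∧ |d| ≤ (X : ℤ) ∧ d % 4 = 1} -
      (Nat.card {d : ℤ | Squarefree d ∧ |d| ≤ (X : ℤ) ∧ (d % 4 = 1 ∧ ¬ R d)} : ℝ) /
        Nat.card {d : ℤ | Squarefree d ∧ |d| ≤ (X : ℤ) ∧ d % 4 = 1}) atTop (𝓝 δ) := by
    simpa using hP.sub hnR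
  have hhi : Tendsto (fun X : ℕ ↦ (Nat.card {d : ℤ | Squarefree d ∧ |d| ≤ (X : ℤ) ∧
      (d % 4 = 1 ∧ P d)} : ℝ) / Nat.card {d : ℤ | Squarefree d ∧ |d| ≤ (X : ℤ) ∧ d % 4 = 1} +
      (Nat.card {d : ℤ | Squarefree d ∧ |d| ≤ (X : ℤ) ∧ (d % 4 = 1 ∧ ¬ R d)} : ℝ) /
        Nat.card {d : ℤ | Squarefree d ∧ |d| ≤ (X : ℤ) ∧ d % 4 = 1}) atTop (𝓝 δ) := by
    simpa using hP.add hnR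
  refine tendsto_of_tendsto_of_tendsto_of_le_of_le' hlo hhi ?_ ?_
  · filter_upwards [eventually_ge_atTop 1] with X hX
    have hF0 := natCard_emod_four_pos hX
    rw [← sub_div, div_le_div_iff_of_pos_right hF0]
    linarith [hPle X]
  · filter_upwards [eventually_ge_atTop 1] with X hX
    have hF0 := natCard_emod_four_pos hX
    rw [← add_div, div_le_div_iff_of_pos_right hF0]
    linarith [hQle X]

/-- **Intersecting with a `100 %` subset of `𝓕`.** If `P` holds for a proportion `→ δ` and `R` for
`100 %` of `𝓕`, then `P ∧ R` holds for a proportion `→ δ`. [folklore] -/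
theorem tendsto_familyProportion_and_one {P R : ℤ → Prop} {δ : ℝ}
    (hP : Tendsto (fun X : ℕ ↦ (Nat.card {d : ℤ | Squarefree d ∧ |d| ≤ (X : ℤ) ∧ (d % 4 = 1 ∧ P d)} : ℝ) /
      Nat.card {d : ℤ | Squarefree d ∧ |d| ≤ (X : ℤ) ∧ d % 4 = 1}) atTop (𝓝 δ))
    (hR : Tendsto (fun X : ℕ ↦ (Nat.card {d : ℤ | Squarefree d ∧ |d| ≤ (X : ℤ) ∧ (d % 4 = 1 ∧ R d)} : ℝ) /
      Nat.card {d : ℤ | Squarefree d ∧ |d| ≤ (X : ℤ) ∧ d % 4 = 1}) atTop (𝓝 1)) :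
    Tendsto (fun X : ℕ ↦ (Nat.card {d : ℤ | Squarefree d ∧ |d| ≤ (X : ℤ) ∧ (d % 4 = 1 ∧ (P d ∧ R d))} : ℝ) /
      Nat.card {d : ℤ | Squarefree d ∧ |d| ≤ (X : ℤ) ∧ d % 4 = 1}) atTop (𝓝 δ) :=
  tendsto_familyProportion_of_congr_one hP hR fun _ _ _ hRd ↦ by simp [hRd]

variable (W : WeierstrassCurve ℚ) [W.IsElliptic]

/-- **Equidistribution of the root number in the good family** `𝓕 = {d squarefree : d ≡ 1 (mod 4)}`:
for an elliptic `W / ℚ`, the twists `W^d`, `d ∈ 𝓕`, with global root number `+1` make up `50 %`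
of `𝓕` (relative density `1/2`) — from the Modularity Theorem `exists_isNewformOf` alone.
[cite: MurtyMurty1997, Ch. 6 §1] -/
theorem tendsto_familyProportion_rootNumber_eq_one (hmod : exists_isNewformOf) :
    Tendsto (fun X : ℕ ↦ (Nat.card {d : ℤ | Squarefree d ∧ |d| ≤ (X : ℤ) ∧
      (d % 4 = 1 ∧ (W.quadraticTwist (d : ℚ)).rootNumber = 1)} : ℝ) /
      Nat.card {d : ℤ | Squarefree d ∧ |d| ≤ (X : ℤ) ∧ d % 4 = 1}) atTop (𝓝 (1 / 2)) := by
  obtain ⟨C, hC⟩ := abs_two_mul_natCard_rootNumber_sub_natCard_emod_four_le W hmod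
  exact tendsto_familyProportion_half_of_abs_le hC

/-- The complementary half: root number `−1` for `50 %` of `d ∈ 𝓕`. [cite: MurtyMurty1997, Ch. 6 §1] -/
theorem tendsto_familyProportion_rootNumber_eq_neg_one (hmod : exists_isNewformOf) :
    Tendsto (fun X : ℕ ↦ (Nat.card {d : ℤ | Squarefree d ∧ |d| ≤ (X : ℤ) ∧
      (d % 4 = 1 ∧ (W.quadraticTwist (d : ℚ)).rootNumber = -1)} : ℝ) /
      Nat.card {d : ℤ | Squarefree d ∧ |d| ≤ (X : ℤ) ∧ d % 4 = 1}) atTop (𝓝 (1 / 2)) := by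
  have h := tendsto_familyProportion_compl (tendsto_familyProportion_rootNumber_eq_one W hmod)
  rw [sub_half] at h
  rw [familyProportion_congr (Q := fun d ↦ (W.quadraticTwist (d : ℚ)).rootNumber = -1)
    (fun d hd _ ↦ ?_)] at h
  · exact h
  · rcases WeierstrassCurve.rootNumber_eq_one_or (W.quadraticTwist (d : ℚ)) with h1 | h1 <;>
      simp [h1]

end Density

end Summit.BirchSwinnertonDyer.BirchSwinnertonDyer.Theorems.GoldfeldGoodTwists

end
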